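import Summits.AtomisticToContinuum.Crystallization.Theorems.OverbindingBudgetAffineMesoCut

/-!
# Overbinding budget — «PhaseCut», part A: the STACKING LETTER of a registered site, the three counts, counting and packing (PROVED)

decomp-a2c lens-4 («minimal counterexample / extremal reduction»), generation 75, part A of a two-part node; part B =
`…Theorems.OverbindingBudgetAffinePhaseCut` (the three census statements, the seam, the transfer, weaker sides, record cones).
Imports ONLY the g74 tree node `…Theorems.OverbindingBudgetAffineMesoCut` (hence `…AffineMesoCutA`, `…AffineLadder`, …) and restates nothing.

* §1 `CFramed` / `HFramed` — the two LETTERS hidden in the tree's `Framed ε g` (`P = fccTwoShellPattern ∨ P = hcpTwoShellPattern`):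
  `Framed ↔ CFramed ∨ HFramed` (`framed_iff`), so a registered site that is not cubic-lettered is hexagonal-lettered, and vice versa.
  `CNear r ε g y i` / `HNear r ε g y i` — some cubic- / hexagonal-lettered site lies within `r·nn_i` of `y i`; the two SINGLE-PHASE normal
  forms `hFramed_near_of_not_cNear` / `cFramed_near_of_not_hNear` (a `ρ`-deep site with no `c` (resp. no `h`) within `r ≤ ρ` has an all-`h`
  (resp. all-`c`) `r`-ball).
* §2 the five counts: `cubicRoughCount` (MID_aff-priced ∧ `c`-proximate), `hexRoughCount` (MID_aff-priced ∧ NOT `c`-proximate: pure-`h` ball),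
  `fccRoughCount` (MID_aff-priced ∧ `c`-proximate ∧ NOT `h`-proximate: pure-`c` ball), `mixedRoughCount` (MID_aff-priced, both letters within `r`),
  `cubicCount ρc` (`ρc`-deeply registered ∧ cubic-lettered); the PARTITIONS `#MID_aff ≤ #cubicRough + #hexRough`,
  `#cubicRough ≤ #fccRough + #mixedRough`, the sub-count inequalities, radius monotonicity.
* §3 `deepReg_of_near` (depth transfer `r(ρc+1) ≤ ρ`) and the SHADOW PACKING `#cubicRough ≤ 27(2rσ₂+σ₁)³/σ₁³·#cubic(ρc) + #off`
  (every in-window cubic-proximate priced site lies within `rσ₂` of a `ρc`-deep cubic-lettered site; in-window sites are `σ₁`-separated;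
  `card_le_of_cube` BY NAME — the fibre argument of g74's `notDeepCount_depth_le`).

0 sorry · Mathlib + tree only · no new axioms · no instance / notation beyond the tree's file-local `E3`.
-/

namespace Summit.AtomisticToContinuum.Crystallization.Theorems.OverbindingBudgetAffinePhaseCut

open scoped BigOperators Classical
open Literature.MathematicalPhysics.StatisticalMechanics
open Literature.Geometry.DiscreteGeometry (IsChargeFree nearestDist nearestDist_nonneg nearestDist_le_dist fccTwoShellPattern hcpTwoShellPattern)
open Summit.AtomisticToContinuum.Crystallization.Theorems.OverbindingBudgetMisfitCensusStatements (card_le_of_cube)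
open Summit.AtomisticToContinuum.Crystallization.Theorems.OverbindingBudgetMisfitRegistration (Framed Reg DeepReg)
open Summit.AtomisticToContinuum.Crystallization.Theorems.OverbindingBudgetMisfitWindowStatements (InWindow offCount)
open Summit.AtomisticToContinuum.Crystallization.Theorems.OverbindingBudgetBalancedCensusStatements
open Summit.AtomisticToContinuum.Crystallization.Theorems.OverbindingBudgetAffineLadder
open Summit.AtomisticToContinuum.Crystallization.Theorems.OverbindingBudgetAffineMesoCut

variable {N : ℕ}

local notation "E3" => EuclideanSpace ℝ (Fin 3)

/-! ## §1  The stacking letter of a framed site (PROVED, definitional) -/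

/-- `CFramed ε g y i` («cubic-lettered»): `i` is two-shell framed BY THE FCC PATTERN — the tree's `Framed ε g y i` with its pattern
disjunct fixed to `fccTwoShellPattern` (cuboctahedral first shell: the two neighbouring close-packed layers occupy DIFFERENT positions). -/
def CFramed (ε g : ℝ) (y : Fin N → E3) (i : Fin N) : Prop :=
  ∃ (A : E3 →ₗᵢ[ℝ] E3) (f : E3 → E3),
    (∀ v ∈ fccTwoShellPattern, f v ∈ Set.range y ∧ dist (f v) (y i + nearestDist y i • A v) ≤ ε * nearestDist y i) ∧
    Set.InjOn f ↑fccTwoShellPattern ∧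
    ∀ k : Fin N, k ≠ i → dist (y k) (y i) ≤ (3 / 2 + g) * nearestDist y i → ∃ v ∈ fccTwoShellPattern, f v = y k

/-- `HFramed ε g y i` («hexagonal-lettered»): `Framed ε g y i` with the pattern fixed to `hcpTwoShellPattern` (anticuboctahedral first
shell: the two neighbouring layers occupy the SAME position). -/
def HFramed (ε g : ℝ) (y : Fin N → E3) (i : Fin N) : Prop :=
  ∃ (A : E3 →ₗᵢ[ℝ] E3) (f : E3 → E3),
    (∀ v ∈ hcpTwoShellPattern, f v ∈ Set.range y ∧ dist (f v) (y i + nearestDist y i • A v) ≤ ε * nearestDist y i) ∧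
    Set.InjOn f ↑hcpTwoShellPattern ∧
    ∀ k : Fin N, k ≠ i → dist (y k) (y i) ≤ (3 / 2 + g) * nearestDist y i → ∃ v ∈ hcpTwoShellPattern, f v = y k

/-- **The letter disjunction**: `Framed ε g y i ↔ CFramed ε g y i ∨ HFramed ε g y i`. [this file] -/
theorem framed_iff {ε g : ℝ} {y : Fin N → E3} {i : Fin N} : Framed ε g y i ↔ CFramed ε g y i ∨ HFramed ε g y i := by
  constructor
  · rintro ⟨A, P, f, hP, h1, h2, h3⟩
    rcases hP with rfl | rfl
    · exact Or.inl ⟨A, f, h1, h2, h3⟩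
    · exact Or.inr ⟨A, f, h1, h2, h3⟩
  · rintro (⟨A, f, h1, h2, h3⟩ | ⟨A, f, h1, h2, h3⟩)
    · exact ⟨A, _, f, Or.inl rfl, h1, h2, h3⟩
    · exact ⟨A, _, f, Or.inr rfl, h1, h2, h3⟩

/-- A cubic-lettered site is framed. [this file] -/
theorem framed_of_cFramed {ε g : ℝ} {y : Fin N → E3} {i : Fin N} (h : CFramed ε g y i) : Framed ε g y i :=
  framed_iff.2 (Or.inl h)

/-- A hexagonal-lettered site is framed. [this file] -/
theorem framed_of_hFramed {ε g : ℝ} {y : Fin N → E3} {i : Fin N} (h : HFramed ε g y i) : Framed ε g y i :=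
  framed_iff.2 (Or.inr h)

/-- A registered site that is not cubic-lettered is hexagonal-lettered. [this file] -/
theorem hFramed_of_reg_not_cFramed {ε g : ℝ} {y : Fin N → E3} {i : Fin N} (h : Reg ε g y i) (hc : ¬ CFramed ε g y i) :
    HFramed ε g y i :=
  (framed_iff.1 h.2).resolve_left hc

/-- `CNear r ε g y i` («cubic-proximate»): some cubic-lettered site lies within `r · nearestDist y i` of `y i` (possibly `i` itself). -/
def CNear (r ε g : ℝ) (y : Fin N → E3) (i : Fin N) : Prop :=
  ∃ j : Fin N, dist (y j) (y i) ≤ r * nearestDist y i ∧ CFramed ε g y j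

/-- `CNear` is monotone in the radius. [this file] -/
theorem cNear_mono {r r' ε g : ℝ} (hr : r ≤ r') {y : Fin N → E3} {i : Fin N} (h : CNear r ε g y i) : CNear r' ε g y i := by
  obtain ⟨j, hd, hj⟩ := h
  exact ⟨j, hd.trans (mul_le_mul_of_nonneg_right hr (nearestDist_nonneg y i)), hj⟩

/-- **The hexagonal normal form (local)**: if `i` is `ρ`-deeply registered, `r ≤ ρ` and NO cubic-lettered site lies within `r·nn_i`, then
EVERY site within `r·nn_i` of `y i` is hexagonal-lettered (the `r`-ball is single-phase hcp-registered: an all-`h` word is `ABAB…`). [this file] -/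
theorem hFramed_near_of_not_cNear {ρ r ε g : ℝ} (hr : r ≤ ρ) {y : Fin N → E3} {i : Fin N} (hi : DeepReg ρ ε g y i)
    (hn : ¬ CNear r ε g y i) {j : Fin N} (hd : dist (y j) (y i) ≤ r * nearestDist y i) : HFramed ε g y j :=
  hFramed_of_reg_not_cFramed (hi j (hd.trans (mul_le_mul_of_nonneg_right hr (nearestDist_nonneg y i))))
    fun hc => hn ⟨j, hd, hc⟩

/-- `HNear r ε g y i` («hexagonal-proximate»): some hexagonal-lettered site lies within `r · nearestDist y i` of `y i`. -/
def HNear (r ε g : ℝ) (y : Fin N → E3) (i : Fin N) : Prop :=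
  ∃ j : Fin N, dist (y j) (y i) ≤ r * nearestDist y i ∧ HFramed ε g y j

/-- `HNear` is monotone in the radius. [this file] -/
theorem hNear_mono {r r' ε g : ℝ} (hr : r ≤ r') {y : Fin N → E3} {i : Fin N} (h : HNear r ε g y i) : HNear r' ε g y i := by
  obtain ⟨j, hd, hj⟩ := h
  exact ⟨j, hd.trans (mul_le_mul_of_nonneg_right hr (nearestDist_nonneg y i)), hj⟩

/-- A registered site that is not hexagonal-lettered is cubic-lettered. [this file] -/
theorem cFramed_of_reg_not_hFramed {ε g : ℝ} {y : Fin N → E3} {i : Fin N} (h : Reg ε g y i) (hh : ¬ HFramed ε g y i) :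
    CFramed ε g y i :=
  (framed_iff.1 h.2).resolve_right hh

/-- **The cubic normal form (local)**: if `i` is `ρ`-deeply registered, `r ≤ ρ` and NO hexagonal-lettered site lies within `r·nn_i`, then EVERY
site within `r·nn_i` of `y i` is cubic-lettered (the `r`-ball is single-phase fcc-registered: an all-`c` word is `ABCABC…`, a BRAVAIS lattice). [this file] -/
theorem cFramed_near_of_not_hNear {ρ r ε g : ℝ} (hr : r ≤ ρ) {y : Fin N → E3} {i : Fin N} (hi : DeepReg ρ ε g y i)
    (hn : ¬ HNear r ε g y i) {j : Fin N} (hd : dist (y j) (y i) ≤ r * nearestDist y i) : CFramed ε g y j :=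
  cFramed_of_reg_not_hFramed (hi j (hd.trans (mul_le_mul_of_nonneg_right hr (nearestDist_nonneg y i))))
    fun hc => hn ⟨j, hd, hc⟩

/-- A `ρ`-deep site (`0 ≤ ρ`, `0 ≤ r`) with no hexagonal-lettered site within `r·nn` is itself cubic-lettered, hence cubic-proximate. [this file] -/
theorem cNear_of_deepReg_not_hNear {ρ r ε g : ℝ} (hρ : 0 ≤ ρ) (hr : 0 ≤ r) {y : Fin N → E3} {i : Fin N} (hi : DeepReg ρ ε g y i)
    (hn : ¬ HNear r ε g y i) : CNear r ε g y i := by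
  have h0 : dist (y i) (y i) ≤ r * nearestDist y i := by
    rw [dist_self]; exact mul_nonneg hr (nearestDist_nonneg y i)
  have hρ0 : dist (y i) (y i) ≤ ρ * nearestDist y i := by
    rw [dist_self]; exact mul_nonneg hρ (nearestDist_nonneg y i)
  exact ⟨i, h0, cFramed_of_reg_not_hFramed (hi i hρ0) fun hc => hn ⟨i, h0, hc⟩⟩

/-! ## §2  The five counts and the counting identities (PROVED) -/

/-- Number of CUBIC-PROXIMATE ROUGH sites: `(ρ, ε)`-deep, NOT affinely `(ρ₁, ε₁, θ)`-deep (the MID_aff-priced sites), with a cubic-lettered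
site within `r·nn` (the priced set of PC). -/
noncomputable def cubicRoughCount (ρ ρ₁ ε₁ θ ε g r : ℝ) (y : Fin N → E3) : ℕ :=
  Nat.card {i : Fin N // (DeepReg ρ ε g y i ∧ ¬ AffDeepReg ρ₁ ε₁ θ g y i) ∧ CNear r ε g y i}

/-- Number of HEXAGONAL-PHASE ROUGH sites: MID_aff-priced sites with NO cubic-lettered site within `r·nn` (the priced set of QH). -/
noncomputable def hexRoughCount (ρ ρ₁ ε₁ θ ε g r : ℝ) (y : Fin N → E3) : ℕ :=
  Nat.card {i : Fin N // (DeepReg ρ ε g y i ∧ ¬ AffDeepReg ρ₁ ε₁ θ g y i) ∧ ¬ CNear r ε g y i}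

/-- Number of PURE-CUBIC-BALL ROUGH sites: MID_aff-priced, cubic-proximate, with NO hexagonal-lettered site within `r·nn` (the priced set of QC). -/
noncomputable def fccRoughCount (ρ ρ₁ ε₁ θ ε g r : ℝ) (y : Fin N → E3) : ℕ :=
  Nat.card {i : Fin N // (DeepReg ρ ε g y i ∧ ¬ AffDeepReg ρ₁ ε₁ θ g y i) ∧ CNear r ε g y i ∧ ¬ HNear r ε g y i}

/-- Number of TWO-LETTER-BALL ROUGH sites: MID_aff-priced with BOTH a cubic- and a hexagonal-lettered site within `r·nn` (stacking-interface
roughness; the priced set of PM). -/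
noncomputable def mixedRoughCount (ρ ρ₁ ε₁ θ ε g r : ℝ) (y : Fin N → E3) : ℕ :=
  Nat.card {i : Fin N // (DeepReg ρ ε g y i ∧ ¬ AffDeepReg ρ₁ ε₁ θ g y i) ∧ CNear r ε g y i ∧ HNear r ε g y i}

/-- Number of `ρc`-deeply registered CUBIC-LETTERED sites (the priced set of the hexagonal-dominance census HD). -/
noncomputable def cubicCount (ρc ε g : ℝ) (y : Fin N → E3) : ℕ :=
  Nat.card {i : Fin N // DeepReg ρc ε g y i ∧ CFramed ε g y i}

/-- THE CUT IS A PARTITION (excluded middle on cubic proximity): `#MID_aff ≤ #cubicRough + #hexRough`. [this file] -/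
theorem affMidCount_le_cubicRough_add_hexRough {ρ ρ₁ ε₁ θ ε g r : ℝ} (y : Fin N → E3) :
    affMidCount ρ ρ₁ ε₁ θ ε g y ≤ cubicRoughCount ρ ρ₁ ε₁ θ ε g r y + hexRoughCount ρ ρ₁ ε₁ θ ε g r y := by
  simp only [affMidCount, cubicRoughCount, hexRoughCount, Nat.card_eq_fintype_card, Fintype.card_subtype]
  calc (Finset.univ.filter fun i => DeepReg ρ ε g y i ∧ ¬ AffDeepReg ρ₁ ε₁ θ g y i).card
      ≤ ((Finset.univ.filter fun i => (DeepReg ρ ε g y i ∧ ¬ AffDeepReg ρ₁ ε₁ θ g y i) ∧ CNear r ε g y i) ∪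
          (Finset.univ.filter fun i => (DeepReg ρ ε g y i ∧ ¬ AffDeepReg ρ₁ ε₁ θ g y i) ∧ ¬ CNear r ε g y i)).card := by
        apply Finset.card_le_card
        intro i hi
        rw [Finset.mem_filter] at hi
        rw [Finset.mem_union, Finset.mem_filter, Finset.mem_filter]
        by_cases hC : CNear r ε g y i
        · exact Or.inl ⟨hi.1, hi.2, hC⟩
        · exact Or.inr ⟨hi.1, hi.2, hC⟩
    _ ≤ _ := Finset.card_union_le _ _

/-- Each half is a sub-count of MID_aff: `#cubicRough ≤ #MID_aff`. [this file] -/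
theorem cubicRoughCount_le_affMidCount {ρ ρ₁ ε₁ θ ε g r : ℝ} (y : Fin N → E3) :
    cubicRoughCount ρ ρ₁ ε₁ θ ε g r y ≤ affMidCount ρ ρ₁ ε₁ θ ε g y := by
  simp only [affMidCount, cubicRoughCount, Nat.card_eq_fintype_card, Fintype.card_subtype]
  apply Finset.card_le_card
  intro i hi
  rw [Finset.mem_filter] at hi ⊢
  exact ⟨hi.1, hi.2.1⟩

/-- `#hexRough ≤ #MID_aff`. [this file] -/
theorem hexRoughCount_le_affMidCount {ρ ρ₁ ε₁ θ ε g r : ℝ} (y : Fin N → E3) :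
    hexRoughCount ρ ρ₁ ε₁ θ ε g r y ≤ affMidCount ρ ρ₁ ε₁ θ ε g y := by
  simp only [affMidCount, hexRoughCount, Nat.card_eq_fintype_card, Fintype.card_subtype]
  apply Finset.card_le_card
  intro i hi
  rw [Finset.mem_filter] at hi ⊢
  exact ⟨hi.1, hi.2.1⟩

/-- THE SECOND CUT IS A PARTITION (excluded middle on hexagonal proximity): `#cubicRough ≤ #fccRough + #mixedRough`. [this file] -/
theorem cubicRoughCount_le_fccRough_add_mixedRough {ρ ρ₁ ε₁ θ ε g r : ℝ} (y : Fin N → E3) :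
    cubicRoughCount ρ ρ₁ ε₁ θ ε g r y ≤ fccRoughCount ρ ρ₁ ε₁ θ ε g r y + mixedRoughCount ρ ρ₁ ε₁ θ ε g r y := by
  simp only [cubicRoughCount, fccRoughCount, mixedRoughCount, Nat.card_eq_fintype_card, Fintype.card_subtype]
  calc (Finset.univ.filter fun i => (DeepReg ρ ε g y i ∧ ¬ AffDeepReg ρ₁ ε₁ θ g y i) ∧ CNear r ε g y i).card
      ≤ ((Finset.univ.filter fun i => (DeepReg ρ ε g y i ∧ ¬ AffDeepReg ρ₁ ε₁ θ g y i) ∧ CNear r ε g y i ∧ ¬ HNear r ε g y i) ∪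
          (Finset.univ.filter fun i => (DeepReg ρ ε g y i ∧ ¬ AffDeepReg ρ₁ ε₁ θ g y i) ∧ CNear r ε g y i ∧ HNear r ε g y i)).card := by
        apply Finset.card_le_card
        intro i hi
        rw [Finset.mem_filter] at hi
        rw [Finset.mem_union, Finset.mem_filter, Finset.mem_filter]
        by_cases hH : HNear r ε g y i
        · exact Or.inr ⟨hi.1, hi.2.1, hi.2.2, hH⟩
        · exact Or.inl ⟨hi.1, hi.2.1, hi.2.2, hH⟩
    _ ≤ _ := Finset.card_union_le _ _

/-- `#fccRough ≤ #cubicRough`. [this file] -/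
theorem fccRoughCount_le_cubicRoughCount {ρ ρ₁ ε₁ θ ε g r : ℝ} (y : Fin N → E3) :
    fccRoughCount ρ ρ₁ ε₁ θ ε g r y ≤ cubicRoughCount ρ ρ₁ ε₁ θ ε g r y := by
  simp only [fccRoughCount, cubicRoughCount, Nat.card_eq_fintype_card, Fintype.card_subtype]
  apply Finset.card_le_card
  intro i hi
  rw [Finset.mem_filter] at hi ⊢
  exact ⟨hi.1, hi.2.1, hi.2.2.1⟩

/-- `#mixedRough ≤ #cubicRough`. [this file] -/
theorem mixedRoughCount_le_cubicRoughCount {ρ ρ₁ ε₁ θ ε g r : ℝ} (y : Fin N → E3) :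
    mixedRoughCount ρ ρ₁ ε₁ θ ε g r y ≤ cubicRoughCount ρ ρ₁ ε₁ θ ε g r y := by
  simp only [mixedRoughCount, cubicRoughCount, Nat.card_eq_fintype_card, Fintype.card_subtype]
  apply Finset.card_le_card
  intro i hi
  rw [Finset.mem_filter] at hi ⊢
  exact ⟨hi.1, hi.2.1, hi.2.2.1⟩

/-- Radius monotonicity: `r ≤ r' ⇒ #mixedRough(r) ≤ #mixedRough(r')`. [this file] -/
theorem mixedRoughCount_mono_radius {ρ ρ₁ ε₁ θ ε g r r' : ℝ} (hr : r ≤ r') (y : Fin N → E3) :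
    mixedRoughCount ρ ρ₁ ε₁ θ ε g r y ≤ mixedRoughCount ρ ρ₁ ε₁ θ ε g r' y := by
  simp only [mixedRoughCount, Nat.card_eq_fintype_card, Fintype.card_subtype]
  apply Finset.card_le_card
  intro i hi
  rw [Finset.mem_filter] at hi ⊢
  exact ⟨hi.1, hi.2.1, cNear_mono hr hi.2.2.1, hNear_mono hr hi.2.2.2⟩

/-- Radius monotonicity: `r ≤ r' ⇒ #cubicRough(r) ≤ #cubicRough(r')`. [this file] -/
theorem cubicRoughCount_mono_radius {ρ ρ₁ ε₁ θ ε g r r' : ℝ} (hr : r ≤ r') (y : Fin N → E3) :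
    cubicRoughCount ρ ρ₁ ε₁ θ ε g r y ≤ cubicRoughCount ρ ρ₁ ε₁ θ ε g r' y := by
  simp only [cubicRoughCount, Nat.card_eq_fintype_card, Fintype.card_subtype]
  apply Finset.card_le_card
  intro i hi
  rw [Finset.mem_filter] at hi ⊢
  exact ⟨hi.1, hi.2.1, cNear_mono hr hi.2.2⟩

/-- Radius antitonicity: `r ≤ r' ⇒ #hexRough(r') ≤ #hexRough(r)`. [this file] -/
theorem hexRoughCount_anti_radius {ρ ρ₁ ε₁ θ ε g r r' : ℝ} (hr : r ≤ r') (y : Fin N → E3) :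
    hexRoughCount ρ ρ₁ ε₁ θ ε g r' y ≤ hexRoughCount ρ ρ₁ ε₁ θ ε g r y := by
  simp only [hexRoughCount, Nat.card_eq_fintype_card, Fintype.card_subtype]
  apply Finset.card_le_card
  intro i hi
  rw [Finset.mem_filter] at hi ⊢
  exact ⟨hi.1, hi.2.1, fun h => hi.2.2 (cNear_mono hr h)⟩

/-- Depth monotonicity of the cubic count: `ρc ≤ ρc' ⇒ #cubic(ρc') ≤ #cubic(ρc)`. [this file] -/
theorem cubicCount_anti_depth {ρc ρc' ε g : ℝ} (h : ρc ≤ ρc') (y : Fin N → E3) :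
    cubicCount ρc' ε g y ≤ cubicCount ρc ε g y := by
  simp only [cubicCount, Nat.card_eq_fintype_card, Fintype.card_subtype]
  apply Finset.card_le_card
  intro i hi
  rw [Finset.mem_filter] at hi ⊢
  exact ⟨hi.1, deepReg_anti h hi.2.1, hi.2.2⟩

/-! ## §3  Depth transfer and the SHADOW PACKING of cubic-proximate sites onto cubic-lettered sites (PROVED) -/

/-- **Depth transfer**: if `i` is `ρ`-deeply registered and `y j` lies within `r·nn_i` (`r ≥ 1`), then `nn_j ≤ r·nn_i` and `j` is
`ρc`-deeply registered as soon as `r(ρc + 1) ≤ ρ`. [this file] -/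
theorem deepReg_of_near {ρ ρc r ε g : ℝ} (hr : 1 ≤ r) (hρc : 0 ≤ ρc) (hρ : r * (ρc + 1) ≤ ρ) {y : Fin N → E3} {i j : Fin N}
    (hi : DeepReg ρ ε g y i) (hd : dist (y j) (y i) ≤ r * nearestDist y i) : DeepReg ρc ε g y j := by
  have hn0 : 0 ≤ nearestDist y i := nearestDist_nonneg y i
  have hnn : nearestDist y j ≤ r * nearestDist y i := by
    by_cases hji : j = i
    · rw [hji]; nlinarith
    · exact (nearestDist_le_dist y (Ne.symm hji)).trans hd
  intro k hk
  apply hi k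
  calc dist (y k) (y i) ≤ dist (y k) (y j) + dist (y j) (y i) := dist_triangle _ _ _
    _ ≤ ρc * nearestDist y j + r * nearestDist y i := add_le_add hk hd
    _ ≤ ρc * (r * nearestDist y i) + r * nearestDist y i := by nlinarith [mul_le_mul_of_nonneg_left hnn hρc]
    _ = r * (ρc + 1) * nearestDist y i := by ring
    _ ≤ ρ * nearestDist y i := mul_le_mul_of_nonneg_right hρ hn0

/-- **Shadow packing**: `#cubicRough(ρ, r) ≤ 27(2rσ₂+σ₁)³/σ₁³ · #cubic(ρc) + #off` whenever `1 ≤ r`, `0 ≤ ρc`, `r(ρc+1) ≤ ρ`,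
`0 < σ₁ ≤ σ₂` — an in-window cubic-proximate `ρ`-deep site lies within `rσ₂` of a cubic-lettered site, which is `ρc`-deep by
`deepReg_of_near`, and in-window sites are `σ₁`-separated (`card_le_of_cube`). [this file] -/
theorem cubicRoughCount_le_cubicCount {ρ ρ₁ ε₁ θ ε g r ρc σ₁ σ₂ : ℝ} (hr : 1 ≤ r) (hρc : 0 ≤ ρc) (hρ : r * (ρc + 1) ≤ ρ)
    (hσ : 0 < σ₁) (hσσ : σ₁ ≤ σ₂) {y : Fin N → E3} (hy : Function.Injective y) :
    (cubicRoughCount ρ ρ₁ ε₁ θ ε g r y : ℝ) ≤ 27 / σ₁ ^ 3 * (2 * r * σ₂ + σ₁) ^ 3 * cubicCount ρc ε g y + offCount σ₁ σ₂ y := by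
  classical
  set K : ℝ := 27 / σ₁ ^ 3 * (2 * r * σ₂ + σ₁) ^ 3 with hK
  set S : Finset (Fin N) := Finset.univ.filter
    (fun i => InWindow σ₁ σ₂ y i ∧ ((DeepReg ρ ε g y i ∧ ¬ AffDeepReg ρ₁ ε₁ θ g y i) ∧ CNear r ε g y i)) with hS
  set B : Finset (Fin N) := Finset.univ.filter (fun j => DeepReg ρc ε g y j ∧ CFramed ε g y j) with hB
  set Of : Finset (Fin N) := Finset.univ.filter (fun i => ¬ InWindow σ₁ σ₂ y i) with hOf
  have hPc : cubicRoughCount ρ ρ₁ ε₁ θ ε g r y =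
      (Finset.univ.filter fun i => (DeepReg ρ ε g y i ∧ ¬ AffDeepReg ρ₁ ε₁ θ g y i) ∧ CNear r ε g y i).card := by
    rw [cubicRoughCount, Nat.card_eq_fintype_card, Fintype.card_subtype]
  have hBc : cubicCount ρc ε g y = B.card := by
    rw [cubicCount, Nat.card_eq_fintype_card, Fintype.card_subtype]
  have hOfc : offCount σ₁ σ₂ y = Of.card := by
    rw [offCount, Nat.card_eq_fintype_card, Fintype.card_subtype]
  -- split the priced sites by the window
  have hsplit : (Finset.univ.filter fun i => (DeepReg ρ ε g y i ∧ ¬ AffDeepReg ρ₁ ε₁ θ g y i) ∧ CNear r ε g y i).card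
      ≤ S.card + Of.card := by
    calc (Finset.univ.filter fun i => (DeepReg ρ ε g y i ∧ ¬ AffDeepReg ρ₁ ε₁ θ g y i) ∧ CNear r ε g y i).card
        ≤ (S ∪ Of).card := by
          apply Finset.card_le_card
          intro i hi
          rw [Finset.mem_filter] at hi
          rw [Finset.mem_union, Finset.mem_filter, Finset.mem_filter]
          by_cases hw : InWindow σ₁ σ₂ y i
          · exact Or.inl ⟨hi.1, hw, hi.2⟩
          · exact Or.inr ⟨hi.1, hw⟩
      _ ≤ S.card + Of.card := Finset.card_union_le _ _
  -- the shadow fibres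
  have hr0 : 0 ≤ r := by linarith
  set T : Fin N → Finset (Fin N) := fun j => S.filter (fun i => dist (y i) (y j) ≤ r * σ₂) with hT
  have hcover : S ⊆ B.biUnion T := by
    intro i hi
    have hi' := (Finset.mem_filter.1 hi).2
    obtain ⟨⟨-, hhi⟩, ⟨hD, -⟩, j, hd, hjC⟩ := hi'
    rw [Finset.mem_biUnion]
    refine ⟨j, Finset.mem_filter.2 ⟨Finset.mem_univ _, deepReg_of_near hr hρc hρ hD hd, hjC⟩, Finset.mem_filter.2 ⟨hi, ?_⟩⟩
    rw [dist_comm]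
    exact hd.trans (mul_le_mul_of_nonneg_left hhi hr0)
  have hfib : ∀ j : Fin N, ((T j).card : ℝ) ≤ K := by
    intro j
    have hcardim : ((T j).image y).card = (T j).card := Finset.card_image_of_injective _ hy
    set o : E3 := WithLp.toLp 2 (fun k : Fin 3 => (y j) k - r * σ₂) with ho
    have hok : ∀ k : Fin 3, o k = (y j) k - r * σ₂ := fun k => rfl
    have hmem : ∀ z ∈ (T j).image y, ∀ k : Fin 3, o k ≤ z k ∧ z k < o k + (2 * r * σ₂ + σ₁) := by
      intro z hz k
      rw [Finset.mem_image] at hz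
      obtain ⟨i, hi, rfl⟩ := hz
      have hd : dist (y i) (y j) ≤ r * σ₂ := (Finset.mem_filter.1 hi).2
      have hk : |(y i) k - (y j) k| ≤ dist (y i) (y j) := by
        rw [← Real.dist_eq]
        exact PiLp.dist_apply_le (y i) (y j) k
      have habs := abs_le.1 (hk.trans hd)
      rw [hok]
      constructor <;> linarith [habs.1, habs.2]
    have hsep : ∀ z ∈ (T j).image y, ∀ w ∈ (T j).image y, z ≠ w → σ₁ ≤ dist z w := by
      intro z hz w hw hzw
      rw [Finset.mem_image] at hz hw
      obtain ⟨i, hi, rfl⟩ := hz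
      obtain ⟨i', hi', rfl⟩ := hw
      have hii : i' ≠ i := fun h => hzw (by rw [h])
      have hwin : InWindow σ₁ σ₂ y i := ((Finset.mem_filter.1 (Finset.mem_filter.1 hi).1).2).1
      exact hwin.1.trans (nearestDist_le_dist y hii)
    have hrσ : 0 ≤ r * σ₂ := mul_nonneg hr0 (by linarith)
    have h := card_le_of_cube (F := (T j).image y) (o := o) hσ (by linarith) hmem hsep
    rw [hcardim] at h
    rw [hK]
    exact h
  have h1 : S.card ≤ (B.biUnion T).card := Finset.card_le_card hcover
  have h2 : (B.biUnion T).card ≤ ∑ j ∈ B, (T j).card := Finset.card_biUnion_le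
  have h3 : (∑ j ∈ B, ((T j).card : ℝ)) ≤ ∑ j ∈ B, K := Finset.sum_le_sum (fun j _ => hfib j)
  rw [Finset.sum_const, nsmul_eq_mul] at h3
  have h12 : (S.card : ℝ) ≤ ∑ j ∈ B, ((T j).card : ℝ) := by exact_mod_cast h1.trans h2
  have hSK : (S.card : ℝ) ≤ K * B.card := by
    calc (S.card : ℝ) ≤ B.card * K := h12.trans h3
      _ = K * B.card := by ring
  have hsplit' : (cubicRoughCount ρ ρ₁ ε₁ θ ε g r y : ℝ) ≤ S.card + Of.card := by rw [hPc]; exact_mod_cast hsplit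
  rw [hBc, hOfc]
  linarith

end Summit.AtomisticToContinuum.Crystallization.Theorems.OverbindingBudgetAffinePhaseCut
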